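import Summits.PneNP.PneNP.Theses.OneSlice
import Summits.PneNP.PneNP.Theorems.SingleThreshold.Negative.LoadBearing
import Literature.Computability.Complexity.RossmanMonotoneCliqueThm2Proofs
import Literature.Computability.Complexity.RossmanMonotoneCliqueLemma23Proofs
import Literature.Computability.Complexity.CliqueThresholdBounds
import Literature.Computability.Complexity.GnpSprinkling

/-!
# The two-round transfer `NoisyIndist(c+1) → SingleThreshold(c)` (Rossman 2010, §7 and App. B)

Route `OneSlice`, crux `Summit.PneNP.PneNP.Theses.OneSlice.SingleThreshold` (stmt-PneNP-2833), line
`two-round-exposure`: the registered stub `stub_twoRoundTransfer` (the lever of the line).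

**What.** Fix an exponent `c`, a clique size `k ≥ 5` and `ε > 0`, and write `p = p_c = n^{-2/(k-1)}`
(critical density, `pc n k`) and `q = pMinus k ε n = n^{-2(1+ε)/(k-1)} ≤ p` (the subcritical
sprinkle density). HYPOTHESIS (NoisyIndist at exponent `c + 1`): for every `γ > 0`, eventually in
`n`, every monotone `{∧₂, ∨₂, 0, 1}`-circuit `D` of size `≤ n^{c+1}` has ADVANTAGE
`adv_q(D) := Σ_y w_q(y)·Pr_A[D(y ∪ K_A) = 1] − Pr_q[D = 1] ≤ γ` (`A` a uniform `k`-set).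
CONCLUSION: `∃ δ > 0`, eventually in `n`, every monotone `{∧₂, ∨₂}`-circuit `C` with
`Pr_p[C ≠ CLIQUE_k] ≤ δ` has more than `n^c` gates (`LowerBoundAt c k δ` of
`Negative/LoadBearing.lean`, which is the crux's inlined matrix by `Iff.rfl`).

**How** (the bookkeeping of `Rossman2010_twoThresholds_of_thm1_lemma23`, with the first exposure
round `H' ∼ G(n, p₁)` in place of the paper's `H`).
* `adv_lower_bound` (ADVANTAGE AT `p`, pointwise in `n`): for a monotone `f` with error `err`,
  `adv_p(f) ≥ Pr_p[ω_k = 0] − 2·err − err / Pr_p[ω_k = 1] − TV₂₃`, where `TV₂₃` is the total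
  variation distance of Lemma 23 (`condOneCliqueLaw` vs `plantedCliqueFreeLaw`). Indeed
  `Pr_p[f = 1] ≤ Pr[ω_k ≥ 1] + err`, and `Σ_z w_p(z) Pr_A[f(z ∪ K_A) = 0]` splits into the
  clique-free part, `≤ err / Pr[ω_k = 1] + TV₂₃` by Lemma 17's second inequality
  (`sum_cliqueFree_mul_kSubsetProb_false_le`), and the part `ω_k(z) ≥ 1`, `≤ err` by monotonicity.
* `adv_union_le` (TRANSFER, pointwise in `n`): by the union law `G(n,p₁) ∪ G(n,q) ∼ G(n, p₁+q−p₁q)`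
  (`sum_sum_gnpWeight_mul_sup`), `adv_{p₁+q−p₁q}(C)` is the `w_{p₁}`-average over the first round
  `x` of `adv_q(C^x)`, `C^x = C(x ∪ ·)` the restriction (`Circuit.exists_restrict_sup`, one more
  gate); so a uniform bound `γ` on the advantages of the restrictions bounds `adv_{p₁+q−p₁q}(C)`.
* `stub_twoRoundTransfer`: with `κ₀ = e^{-2} ≤ Pr_p[ω_k = 0]` (`eventually_le_gnpProb_cliqueFree`),
  `κ₁ ≤ Pr_p[ω_k = 1]` (`eventually_le_gnpProb_cliqueCount_eq_one`), `TV₂₃ → 0`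
  (`Rossman2010_plantedVsConditioned_holds`), take `δ = κ₀κ₁/8` and `γ = κ₀/4`; for `p₁ = (p−q)/(1−q)`
  one has `p₁ + q − p₁q = p`, and a `δ`-accurate monotone `C` of size `≤ n^c` would have
  `κ₀/2 ≤ adv_p(C) ≤ κ₀/4` — contradiction.

## References

* B. Rossman, *The monotone complexity of k-clique on random graphs*, FOCS 2010, 193–201; SIAM J.
  Comput. 43 (2014) 256–279 — §7 (p. 10) and Appendix B (Lemmas 17 and 23, pp. 13–14)
  [Rossman2010].
-/

noncomputable section

set_option linter.dupNamespace false

open Finset Filter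

open scoped Classical Topology

namespace Summit.PneNP.PneNP.Theorems.SingleThreshold

open Literature.Computability.Complexity GateList
open Summit.PneNP.PneNP.Theorems.SingleThreshold.Negative (Edges pc err LowerBoundAt pc_nonneg
  pc_le_one tendsto_pc gnpProb_union_le)

/-! ### The advantage at the critical density (Lemma 17, both halves, pointwise in `n`) -/

/-- `Pr_p[CLIQUE_k = 1] = 1 − Pr_p[ω_k = 0]`. [folklore] -/
theorem gnpProb_cliqueFn_true {n k : ℕ} (p : ℝ) :
    gnpProb n p (univ.filter fun x : Edges n → Bool => cliqueFn n k x = true) =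
      1 - gnpProb n p (univ.filter fun x => cliqueCount n k x = 0) := by
  rw [← gnpProb_compl]
  congr 1
  ext x
  simp only [mem_compl, mem_filter, mem_univ, true_and]
  exact (cliqueCount_ne_zero_iff x).symm

/-- `Pr_p[f = 1] ≤ (1 − Pr_p[ω_k = 0]) + Pr_p[f ≠ CLIQUE_k]`. [folklore] -/
theorem gnpProb_true_le {n k : ℕ} {p : ℝ} (hp0 : 0 ≤ p) (hp1 : p ≤ 1)
    (f : (Edges n → Bool) → Bool) :
    gnpProb n p (univ.filter fun z => f z = true) ≤
      (1 - gnpProb n p (univ.filter fun x => cliqueCount n k x = 0)) +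
        gnpProb n p (univ.filter fun x => f x ≠ cliqueFn n k x) := by
  rw [← gnpProb_cliqueFn_true]
  refine le_trans (gnpProb_mono hp0 hp1 ?_) (gnpProb_union_le hp0 hp1 _ _)
  intro z hz
  simp only [mem_filter, mem_univ, true_and, mem_union] at hz ⊢
  by_cases hc : cliqueFn n k z = true
  · exact Or.inl hc
  · exact Or.inr (by rw [hz]; exact fun h => hc h.symm)

/-- `Σ_z w_p(z)·Pr_A[f(z ∪ K_A) = 1] = 1 − Σ_z w_p(z)·Pr_A[f(z ∪ K_A) = 0]` (`k ≤ n`). [folklore] -/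
theorem sum_kSubsetProb_true_eq {n k : ℕ} (hkn : k ≤ n) (p : ℝ) (f : (Edges n → Bool) → Bool) :
    (∑ z : Edges n → Bool, gnpWeight n p z *
        kSubsetProb n k (fun A => f (z ⊔ cliqueVec A) = true)) =
      1 - ∑ z : Edges n → Bool, gnpWeight n p z *
        kSubsetProb n k (fun A => f (plantClique A z) = false) := by
  have hz : ∀ z : Edges n → Bool, kSubsetProb n k (fun A => f (z ⊔ cliqueVec A) = true) =
      1 - kSubsetProb n k (fun A => f (plantClique A z) = false) := by
    intro z
    rw [← kSubsetProb_not hkn]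
    refine kSubsetProb_congr fun A => ?_
    rw [plantClique_eq_sup, Bool.not_eq_false]
  simp_rw [hz, mul_sub, mul_one, Finset.sum_sub_distrib]
  rw [show (∑ z : Edges n → Bool, gnpWeight n p z) = gnpProb n p univ from rfl, gnpProb_univ]

/-- On the graphs WITH a `k`-clique, a monotone `f` rejects `z ∪ K_A` only if it errs at `z`:
`Σ_{z : ω_k(z) ≥ 1} w_p(z)·Pr_A[f(z ∪ K_A) = 0] ≤ Pr_p[f ≠ CLIQUE_k]`. [folklore] -/
theorem sum_notCliqueFree_mul_kSubsetProb_false_le {n k : ℕ} {p : ℝ} (hp0 : 0 ≤ p) (hp1 : p ≤ 1)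
    (f : (Edges n → Bool) → Bool) (hf : Monotone f) :
    ∑ z ∈ univ.filter (fun z : Edges n → Bool => ¬ cliqueCount n k z = 0),
        gnpWeight n p z * kSubsetProb n k (fun A => f (plantClique A z) = false) ≤
      gnpProb n p (univ.filter fun x => f x ≠ cliqueFn n k x) := by
  rw [gnpProb_filter]
  calc ∑ z ∈ univ.filter (fun z : Edges n → Bool => ¬ cliqueCount n k z = 0),
        gnpWeight n p z * kSubsetProb n k (fun A => f (plantClique A z) = false)
      ≤ ∑ z ∈ univ.filter (fun z : Edges n → Bool => ¬ cliqueCount n k z = 0),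
          (if f z ≠ cliqueFn n k z then gnpWeight n p z else 0) := by
        refine sum_le_sum fun z hz => ?_
        have hcz : cliqueFn n k z = true := (cliqueCount_ne_zero_iff z).1 (mem_filter.1 hz).2
        by_cases hfz : f z = true
        · have h0 : kSubsetProb n k (fun A => f (plantClique A z) = false) = 0 := by
            unfold kSubsetProb
            rw [filter_false_of_mem, card_empty, Nat.cast_zero, zero_div]
            intro A _ hfalse
            have hle : z ≤ plantClique A z := by rw [plantClique_eq_sup]; exact le_sup_left
            have hmono := hf hle
            rw [hfz, hfalse] at hmono
            exact absurd hmono (by decide)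
          rw [h0, mul_zero]
          split_ifs
          · exact gnpWeight_nonneg hp0 hp1 z
          · exact le_rfl
        · have hne : f z ≠ cliqueFn n k z := by rw [hcz]; exact hfz
          rw [if_pos hne]
          calc gnpWeight n p z * kSubsetProb n k (fun A => f (plantClique A z) = false)
              ≤ gnpWeight n p z * 1 :=
                mul_le_mul_of_nonneg_left (kSubsetProb_le_one _ _ _) (gnpWeight_nonneg hp0 hp1 z)
            _ = gnpWeight n p z := mul_one _
    _ ≤ ∑ z, (if f z ≠ cliqueFn n k z then gnpWeight n p z else 0) :=
        sum_le_sum_of_subset_of_nonneg (filter_subset _ _) fun z _ _ => by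
          split_ifs
          · exact gnpWeight_nonneg hp0 hp1 z
          · exact le_rfl

/-- **The advantage at the critical density** (Rossman 2010, Lemma 17, both inequalities, in
advantage form, pointwise in `n`): for a monotone `f`, `p ∈ [0,1]`, `k ≤ n` and `Pr_p[ω_k = 1] > 0`,
`Pr_p[ω_k = 0] − 2·err − err / Pr_p[ω_k = 1] − TV₂₃ ≤ Σ_z w_p(z)·Pr_A[f(z ∪ K_A) = 1] − Pr_p[f = 1]`,
where `err = Pr_p[f ≠ CLIQUE_k]` and `TV₂₃ = Σ_G |Pr[G(n,p) = G | ω_k = 1] − Pr[G(n,p) ∪ K_A = G | ω_k = 0]|`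
(Lemma 23's distance). [cite: Rossman2010, App. B (proof of Lemma 17, p. 14)] -/
theorem adv_lower_bound {n k : ℕ} {p : ℝ} (hp0 : 0 ≤ p) (hp1 : p ≤ 1) (hkn : k ≤ n)
    (f : (Edges n → Bool) → Bool) (hf : Monotone f)
    (hP₁ : 0 < gnpProb n p (univ.filter fun x => cliqueCount n k x = 1)) :
    gnpProb n p (univ.filter fun x => cliqueCount n k x = 0) -
        2 * gnpProb n p (univ.filter fun x => f x ≠ cliqueFn n k x) -
        gnpProb n p (univ.filter fun x => f x ≠ cliqueFn n k x) /
          gnpProb n p (univ.filter fun x => cliqueCount n k x = 1) -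
        ∑ G, |condOneCliqueLaw n k p G - plantedCliqueFreeLaw n k p G| ≤
      (∑ z : Edges n → Bool, gnpWeight n p z *
          kSubsetProb n k (fun A => f (z ⊔ cliqueVec A) = true)) -
        gnpProb n p (univ.filter fun z => f z = true) := by
  have h1 := gnpProb_true_le (k := k) hp0 hp1 f
  have h2 := sum_kSubsetProb_true_eq hkn p f
  have h3 : ∑ z : Edges n → Bool, gnpWeight n p z *
      kSubsetProb n k (fun A => f (plantClique A z) = false) ≤
      (gnpProb n p (univ.filter fun x => f x ≠ cliqueFn n k x) /
          gnpProb n p (univ.filter fun x => cliqueCount n k x = 1) +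
        ∑ G, |condOneCliqueLaw n k p G - plantedCliqueFreeLaw n k p G|) +
      gnpProb n p (univ.filter fun x => f x ≠ cliqueFn n k x) := by
    rw [← sum_filter_add_sum_filter_not univ (fun z : Edges n → Bool => cliqueCount n k z = 0)]
    exact add_le_add (sum_cliqueFree_mul_kSubsetProb_false_le hp0 hp1 hkn f hP₁)
      (sum_notCliqueFree_mul_kSubsetProb_false_le hp0 hp1 f hf)
  linarith

/-! ### The transfer through the union law (two-round exposure) -/

/-- **Two-round exposure of the advantage.** If `G(n, p₁+q−p₁q) = H' ∪ S` with independent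
`H' ∼ G(n,p₁)`, `S ∼ G(n,q)` (union law `sum_sum_gnpWeight_mul_sup`), then the advantage of a
monotone `{∧₂,∨₂,0,1}`-circuit `C` at density `p₁+q−p₁q` is the `w_{p₁}`-average over `H'` of the
advantages at density `q` of the restrictions `C^{H'} = C(H' ∪ ·)` (`Circuit.exists_restrict_sup`,
at most one more gate); hence it is at most any common bound `γ` of the latter.
[cite: Rossman2010, §7 (proof of Thm 2, p. 10) and App. B (proof of Lemma 17, p. 14)] -/
theorem adv_union_le {n k : ℕ} {p₁ q γ : ℝ} (hp0 : 0 ≤ p₁) (hp1 : p₁ ≤ 1)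
    (C : Circuit (Edges n)) (hC : C.IsOver monotoneBasis01)
    (h : ∀ D : Circuit (Edges n), D.IsOver monotoneBasis01 → D.size ≤ C.size + 1 →
      (∑ y : Edges n → Bool, gnpWeight n q y *
          kSubsetProb n k (fun A => D.eval (y ⊔ cliqueVec A) = true)) -
        gnpProb n q (univ.filter fun y => D.eval y = true) ≤ γ) :
    (∑ z : Edges n → Bool, gnpWeight n (p₁ + q - p₁ * q) z *
        kSubsetProb n k (fun A => C.eval (z ⊔ cliqueVec A) = true)) -
      gnpProb n (p₁ + q - p₁ * q) (univ.filter fun z => C.eval z = true) ≤ γ := by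
  have e1 := sum_sum_gnpWeight_mul_sup (n := n) p₁ q
    (fun z => kSubsetProb n k (fun A => C.eval (z ⊔ cliqueVec A) = true))
  have e2 := sum_sum_gnpWeight_ite_sup (n := n) p₁ q (fun z => C.eval z = true)
  -- the advantage of the restriction `C^x`, for every first round `x`
  have hx : ∀ x : Edges n → Bool,
      (∑ y : Edges n → Bool, gnpWeight n q y *
          kSubsetProb n k (fun A => C.eval ((x ⊔ y) ⊔ cliqueVec A) = true)) -
        ∑ y : Edges n → Bool, gnpWeight n q y *
          (if C.eval (x ⊔ y) = true then (1 : ℝ) else 0) ≤ γ := by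
    intro x
    obtain ⟨D, hD, hDsize, hDeval⟩ := C.exists_restrict_sup hC x
    have ha : ∀ y : Edges n → Bool,
        kSubsetProb n k (fun A => C.eval ((x ⊔ y) ⊔ cliqueVec A) = true) =
          kSubsetProb n k (fun A => D.eval (y ⊔ cliqueVec A) = true) := fun y =>
      kSubsetProb_congr fun A => by rw [hDeval, sup_assoc]
    have hb : (∑ y : Edges n → Bool, gnpWeight n q y *
        (if C.eval (x ⊔ y) = true then (1 : ℝ) else 0)) =
        gnpProb n q (univ.filter fun y => D.eval y = true) := by
      rw [gnpProb_filter]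
      refine sum_congr rfl fun y _ => ?_
      rw [hDeval]
      split_ifs <;> simp
    simp_rw [ha]
    rw [hb]
    exact h D hD hDsize
  calc (∑ z : Edges n → Bool, gnpWeight n (p₁ + q - p₁ * q) z *
        kSubsetProb n k (fun A => C.eval (z ⊔ cliqueVec A) = true)) -
      gnpProb n (p₁ + q - p₁ * q) (univ.filter fun z => C.eval z = true)
      = ∑ x : Edges n → Bool, gnpWeight n p₁ x *
          ((∑ y : Edges n → Bool, gnpWeight n q y *
              kSubsetProb n k (fun A => C.eval ((x ⊔ y) ⊔ cliqueVec A) = true)) -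
            ∑ y : Edges n → Bool, gnpWeight n q y *
              (if C.eval (x ⊔ y) = true then (1 : ℝ) else 0)) := by
        rw [← e1, ← e2, ← sum_sub_distrib]
        refine sum_congr rfl fun x _ => ?_
        rw [mul_sub, mul_sum, mul_sum, ← sum_sub_distrib, ← sum_sub_distrib]
        refine sum_congr rfl fun y _ => ?_
        ring
    _ ≤ ∑ x : Edges n → Bool, gnpWeight n p₁ x * γ :=
        sum_le_sum fun x _ => mul_le_mul_of_nonneg_left (hx x) (gnpWeight_nonneg hp0 hp1 x)
    _ = γ := by
        rw [← sum_mul, show (∑ x : Edges n → Bool, gnpWeight n p₁ x) = gnpProb n p₁ univ from rfl,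
          gnpProb_univ, one_mul]

/-! ### Densities -/

/-- `p_c ≤ 1` for every `n` (also `n = 0`, where `p_c = 0`), `k ≥ 2`. [folklore] -/
theorem pc_le_one' (n : ℕ) {k : ℕ} (hk : 2 ≤ k) : pc n k ≤ 1 := by
  rcases Nat.eq_zero_or_pos n with rfl | hn
  · have hk' : (2 : ℝ) ≤ k := by exact_mod_cast hk
    have hne : -(2 : ℝ) / ((k : ℝ) - 1) ≠ 0 := by
      have : (0 : ℝ) < (k : ℝ) - 1 := by linarith
      exact (div_neg_of_neg_of_pos (by norm_num) this).ne
    rw [pc, Nat.cast_zero, Real.zero_rpow hne]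
    exact zero_le_one
  · exact pc_le_one hn hk

/-- The sprinkle density is below the critical one: `pMinus k ε n ≤ p_c` (`n ≥ 1`, `k ≥ 2`,
`ε ≥ 0`). [folklore] -/
theorem pMinus_le_pc {n k : ℕ} {ε : ℝ} (hn : 1 ≤ n) (hk : 2 ≤ k) (hε : 0 ≤ ε) :
    pMinus k ε n ≤ pc n k := by
  have hk' : (2 : ℝ) ≤ k := by exact_mod_cast hk
  have hk1 : (0 : ℝ) < (k : ℝ) - 1 := by linarith
  have hn' : (1 : ℝ) ≤ n := by exact_mod_cast hn
  rw [pMinus, pc]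
  refine Real.rpow_le_rpow_of_exponent_le hn' ?_
  rw [div_le_div_iff_of_pos_right hk1]
  linarith

/-- The sprinkle density is `< 1` for `n ≥ 2` (`k ≥ 2`, `ε ≥ 0`). [folklore] -/
theorem pMinus_lt_one {n k : ℕ} {ε : ℝ} (hn : 2 ≤ n) (hk : 2 ≤ k) (hε : 0 ≤ ε) :
    pMinus k ε n < 1 := by
  have hk' : (2 : ℝ) ≤ k := by exact_mod_cast hk
  have hk1 : (0 : ℝ) < (k : ℝ) - 1 := by linarith
  have hn' : (1 : ℝ) < n := by exact_mod_cast hn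
  rw [pMinus]
  exact Real.rpow_lt_one_of_one_lt_of_neg hn' (div_neg_of_neg_of_pos (by linarith) hk1)

/-! ### The transfer -/

/-- **Two-round transfer `NoisyIndist(c+1) → SingleThreshold(c)`** (stub `stub_twoRoundTransfer`
of line `two-round-exposure`; Rossman 2010, §7 and App. B with the first exposure round in place
of the fixed graph `H`). Given `c`, `k ≥ 5`, `ε > 0`: if for every `γ > 0`, eventually in `n`, no
monotone `{∧₂,∨₂,0,1}`-circuit of size `≤ n^{c+1}` tells `S ∪ K_A` from `S` (`S ∼ G(n, pMinus k ε n)`,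
`A` a uniform `k`-set) with advantage more than `γ`, then there is `δ > 0` such that eventually
every monotone `{∧₂,∨₂}`-circuit with `Pr_{G(n, n^{-2/(k-1)})}[C ≠ CLIQUE_k] ≤ δ` has more than `n^c`
gates. Proof: `δ = κ₀κ₁/8` with `κ₀ ≤ Pr[ω_k = 0]`, `κ₁ ≤ Pr[ω_k = 1]` eventually; a small accurate
`C` has `adv_p(C) ≥ κ₀/2` (`adv_lower_bound`, Lemma 23) and `adv_p(C) ≤ κ₀/4` (`adv_union_le` at
`p₁ = (p − q)/(1 − q)` and the hypothesis at `γ = κ₀/4` for the restrictions, of size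
`≤ n^c + 1 ≤ n^{c+1}`). [cite: Rossman2010, §7 (p. 10) and App. B (Lemmas 17 and 23, pp. 13–14)] -/
theorem stub_twoRoundTransfer :
    ∀ (c k : ℕ) (ε : ℝ), 5 ≤ k → 0 < ε →
      (∀ γ : ℝ, 0 < γ →
      ∀ᶠ n : ℕ in atTop, ∀ D : Circuit (⊤ : SimpleGraph (Fin n)).edgeSet,
        D.IsOver monotoneBasis01 → D.size ≤ n ^ (c + 1) →
          (∑ x : ((⊤ : SimpleGraph (Fin n)).edgeSet → Bool),
              gnpWeight n (pMinus k ε n) x *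
                kSubsetProb n k (fun A => D.eval (x ⊔ cliqueVec A) = true)) -
            gnpProb n (pMinus k ε n) (univ.filter fun x => D.eval x = true) ≤ γ) →
      ∃ δ : ℝ, 0 < δ ∧ ∀ᶠ n : ℕ in Filter.atTop,
        ∀ C : Literature.Computability.Complexity.Circuit ((⊤ : SimpleGraph (Fin n)).edgeSet),
          C.IsOver Literature.Computability.Complexity.monotoneBasis →
            (Finset.univ.filter (fun x : ((⊤ : SimpleGraph (Fin n)).edgeSet) → Bool =>
                C.eval x ≠ decide (¬ (SimpleGraph.fromEdgeSet {e : Sym2 (Fin n) |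
                  ∃ h : e ∈ (⊤ : SimpleGraph (Fin n)).edgeSet, x ⟨e, h⟩ = true}).CliqueFree k))).sum
              (fun x => ((n : ℝ) ^ (-(2 : ℝ) / ((k : ℝ) - 1))) ^ (Finset.univ.filter (fun e => x e = true)).card *
                (1 - (n : ℝ) ^ (-(2 : ℝ) / ((k : ℝ) - 1))) ^
                  (n.choose 2 - (Finset.univ.filter (fun e => x e = true)).card)) ≤ δ →
            n ^ c < C.size := by
  intro c k ε hk hε hN
  suffices h : ∃ δ : ℝ, 0 < δ ∧ LowerBoundAt c k δ by exact h
  have hk2 : 2 ≤ k := le_trans (by norm_num) hk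
  -- the two threshold constants `κ₀ ≤ Pr[ω_k = 0]`, `κ₁ ≤ Pr[ω_k = 1]`
  set κ₀ : ℝ := Real.exp (-(2 * (1 : ℝ) ^ k.choose 2)) with hκ₀
  set κ₁ : ℝ := (1 : ℝ) ^ k.choose 2 / (2 ^ k * k.factorial) *
    Real.exp (-(2 * (k * 2 ^ k * (1 : ℝ) ^ k.choose 2))) with hκ₁
  have hκ₀pos : 0 < κ₀ := Real.exp_pos _
  have hκ₁pos : 0 < κ₁ := by positivity
  refine ⟨κ₀ * κ₁ / 8, by positivity, ?_⟩
  -- the critical density as a threshold function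
  have hp01 : ∀ n : ℕ, 0 ≤ pc n k ∧ pc n k ≤ 1 := fun n => ⟨pc_nonneg n k, pc_le_one' n hk2⟩
  have hab : ∀ᶠ n : ℕ in atTop, 1 * (n : ℝ) ^ (-(2 : ℝ) / ((k : ℝ) - 1)) ≤ pc n k ∧
      pc n k ≤ 1 * (n : ℝ) ^ (-(2 : ℝ) / ((k : ℝ) - 1)) :=
    Eventually.of_forall fun n => by rw [one_mul]; exact ⟨le_rfl, le_rfl⟩
  have hpb : ∀ᶠ n : ℕ in atTop, 0 ≤ pc n k ∧ pc n k ≤ 1 * (n : ℝ) ^ (-(2 : ℝ) / ((k : ℝ) - 1)) :=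
    hab.mono fun n hn => ⟨pc_nonneg n k, hn.2⟩
  have hA : ∀ᶠ n : ℕ in atTop, κ₀ ≤ gnpProb n (pc n k) (univ.filter fun x => cliqueCount n k x = 0) :=
    eventually_le_gnpProb_cliqueFree (p := fun n => pc n k) hk2 le_rfl hpb
  have hE1 : ∀ᶠ n : ℕ in atTop, κ₁ ≤ gnpProb n (pc n k) (univ.filter fun x => cliqueCount n k x = 1) :=
    eventually_le_gnpProb_cliqueCount_eq_one (p := fun n => pc n k) hk2 one_pos le_rfl hab
  -- Lemma 23
  have hTV : Tendsto (fun n => ∑ H : Edges n → Bool,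
      |condOneCliqueLaw n k (pc n k) H - plantedCliqueFreeLaw n k (pc n k) H|) atTop (𝓝 0) :=
    Rossman2010_plantedVsConditioned_holds k hk (fun n => pc n k) hp01 (Asymptotics.isTheta_refl _ _)
  have hTVev : ∀ᶠ n : ℕ in atTop, ∑ H : Edges n → Bool,
      |condOneCliqueLaw n k (pc n k) H - plantedCliqueFreeLaw n k (pc n k) H| ≤ κ₀ / 8 :=
    hTV.eventually_le_const (by positivity)
  -- the hypothesis at `γ = κ₀ / 4`
  have hNγ := hN (κ₀ / 4) (by positivity)
  show ∀ᶠ n : ℕ in atTop, ∀ C : Circuit (Edges n), C.IsOver monotoneBasis →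
    err n k C ≤ κ₀ * κ₁ / 8 → n ^ c < C.size
  filter_upwards [hNγ, hA, hE1, hTVev, eventually_ge_atTop k, eventually_ge_atTop 2] with n hNn hAn
    hE1n hTVn hkn hn2
  intro C hC herr
  by_contra hsz
  push Not at hsz
  -- the densities `q ≤ p ≤ 1` and `p₁ = (p - q)/(1 - q)`
  have hn1 : 1 ≤ n := by omega
  have hp0 : 0 ≤ pc n k := pc_nonneg n k
  have hp1 : pc n k ≤ 1 := pc_le_one hn1 hk2
  have hq0 : 0 ≤ pMinus k ε n := Real.rpow_nonneg (Nat.cast_nonneg n) _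
  have hqp : pMinus k ε n ≤ pc n k := pMinus_le_pc hn1 hk2 hε.le
  have hq1 : pMinus k ε n < 1 := pMinus_lt_one hn2 hk2 hε.le
  have h1q : 0 < 1 - pMinus k ε n := by linarith
  set p₁ : ℝ := (pc n k - pMinus k ε n) / (1 - pMinus k ε n) with hp₁
  have hp₁0 : 0 ≤ p₁ := div_nonneg (by linarith) h1q.le
  have hp₁1 : p₁ ≤ 1 := by rw [hp₁, div_le_one h1q]; linarith
  have hpp : p₁ + pMinus k ε n - p₁ * pMinus k ε n = pc n k := by
    rw [hp₁]
    field_simp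
    ring
  -- `C` is monotone
  have hC01 : C.IsOver monotoneBasis01 := hC.mono monotoneBasis_subset_monotoneBasis01
  have hmono : Monotone C.eval := C.monotone_eval_of_isOver_monotoneBasis01 hC01
  -- UPPER bound on the advantage at `p`: two-round exposure and the hypothesis
  have hupper : (∑ z : Edges n → Bool, gnpWeight n (pc n k) z *
        kSubsetProb n k (fun A => C.eval (z ⊔ cliqueVec A) = true)) -
      gnpProb n (pc n k) (univ.filter fun z => C.eval z = true) ≤ κ₀ / 4 := by
    rw [← hpp]
    refine adv_union_le hp₁0 hp₁1 C hC01 fun D hD hDsize => hNn D hD ?_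
    have h1 : 1 ≤ n ^ c := Nat.one_le_pow _ _ (by omega)
    calc D.size ≤ C.size + 1 := hDsize
      _ ≤ n ^ c + 1 := by omega
      _ ≤ n ^ c * n := by nlinarith
      _ = n ^ (c + 1) := (pow_succ n c).symm
  -- LOWER bound on the advantage at `p`: Lemma 17 / Lemma 23
  have hP₁ : 0 < gnpProb n (pc n k) (univ.filter fun x => cliqueCount n k x = 1) :=
    hκ₁pos.trans_le hE1n
  have hlower := adv_lower_bound hp0 hp1 hkn C.eval hmono hP₁
  have herr' : gnpProb n (pc n k) (univ.filter fun x => C.eval x ≠ cliqueFn n k x) ≤ κ₀ * κ₁ / 8 :=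
    herr
  have herr0 : 0 ≤ gnpProb n (pc n k) (univ.filter fun x => C.eval x ≠ cliqueFn n k x) :=
    gnpProb_nonneg hp0 hp1 _
  have hκ₁1 : κ₁ ≤ 1 := hE1n.trans (gnpProb_le_one hp0 hp1 _)
  have hdiv : gnpProb n (pc n k) (univ.filter fun x => C.eval x ≠ cliqueFn n k x) /
      gnpProb n (pc n k) (univ.filter fun x => cliqueCount n k x = 1) ≤ κ₀ / 8 := by
    rw [div_le_iff₀ hP₁]
    have := mul_le_mul_of_nonneg_left hE1n (by positivity : (0 : ℝ) ≤ κ₀ / 8)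
    linarith
  have h2δ : 2 * (κ₀ * κ₁ / 8) ≤ κ₀ / 4 := by nlinarith
  linarith

end Summit.PneNP.PneNP.Theorems.SingleThreshold

end
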